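import Summits.NavierStokesRegularity.NavierStokesRegularity.Theorems.HardyPointSinkHardyEnergyBoundLedgerSliceIntegrals
import Summits.NavierStokesRegularity.NavierStokesRegularity.Theorems.HardyPointSinkHardyEnergyBoundLedgerKato
import Literature.Analysis.FluidPDE.PassiveScalarProofs
import HarnessLib

/-!
# Route HardyPointSink — `HardyEnergyBound`, line `birth`: tools for the converse CRUX ⇒ HEART

Helper file for the anchor `hardyEnergyBound_influxAbsorption_of_crux` (item
stmt-NavierStokesRegularity-7979, crux `Theses.HardyPointSink.HardyEnergyBound`, file
`…HardyEnergyBoundConverse`). The converse runs the localised Hardy ledger with the plateau cut-off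
of `…LedgerCutoff` CENTRED AT THE SINK `x₀` (scale `ρ = R/4`), so that the slice tools of the ledger
files apply verbatim with `xs := x₀`. This file supplies what is then missing:

* the pointwise comparison `ofReal(φ g / r) ≤ 1_B ofReal(g) / rₑ` for `0 ≤ φ ≤ 1` vanishing off `B`
  (with `ofReal ∫ ≤ ∫⁻ ofReal` of `PassiveScalarProofs` it reads the crux's and the heart's `ℝ≥0∞`
  integrals off the Bochner-form identity without any continuity in time);
* translation covariance of the cut-off (`φ_c = φ_0(· − c)`, same for `Dφ_c`, `Δφ_c`), whence bounds of
  `Dφ_c`, `Δφ_c` uniform in the centre `c`;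
* the influx deficit `|∫_S (φ − 1) flux_Π| ≤ (16/ρ²)(1/2 + C_{3/2}) ∫|w|³` over an ARBITRARY set `S`, and
  the collection `∫_B (φ − 1) flux_Π + ∫_B flux_Π = ∫ φ flux_Π` over any ball `B ⊇ B(c, ρ)` (the heart's
  influx ball `B(xs, R)` is larger than the cut-off ball `B(x₀, R/4)`).
-/

noncomputable section

open MeasureTheory Set Filter Topology Metric Function
open scoped ENNReal NNReal InnerProductSpace Laplacian

set_option linter.dupNamespace false -- nested layout Summit.<S>.<Sub>, Sub = S (D-0017)

namespace Summit.NavierStokesRegularity.NavierStokesRegularity.Theorems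

open Literature.Analysis.FluidPDE Literature.Analysis.PDE

/-! ### A pointwise weight comparison -/

/-- Pointwise: `ofReal(φ g / |x − x₀|) ≤ 1_B · ofReal(g) / |x − x₀|ₑ` whenever `0 ≤ φ ≤ 1` vanishes off
`B` and `g ≥ 0`. -/
theorem hardyEnergyBound_converse_ofReal_weighted_le {φ g : (EuclideanSpace ℝ (Fin 3)) → ℝ}
    {B : Set (EuclideanSpace ℝ (Fin 3))} (h1 : ∀ x, φ x ≤ 1) (hB : ∀ x ∉ B, φ x = 0)
    (hg : ∀ x, 0 ≤ g x) (x₀ x : EuclideanSpace ℝ (Fin 3)) :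
    ENNReal.ofReal (φ x * g x / ‖x - x₀‖) ≤
      B.indicator (fun x => ENNReal.ofReal (g x) / ‖x - x₀‖ₑ) x := by
  by_cases hx : x ∈ B
  · rw [indicator_of_mem hx]
    rcases eq_or_lt_of_le (norm_nonneg (x - x₀)) with hr | hr
    · rw [← hr, div_zero, ENNReal.ofReal_zero]
      exact zero_le
    · rw [← ofReal_norm, ← ENNReal.ofReal_div_of_pos hr]
      exact ENNReal.ofReal_le_ofReal
        (div_le_div_of_nonneg_right (mul_le_of_le_one_left (hg x) (h1 x)) hr.le)
  · rw [indicator_of_notMem hx, hB x hx, zero_mul, zero_div, ENNReal.ofReal_zero]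

/-! ### The ledger cut-off is translation covariant -/

/-- `φ_c(x) = φ_0(x − c)` for the plateau cut-off of `…LedgerCutoff`. -/
theorem hardyEnergyBound_converse_cutoff_translate (c : EuclideanSpace ℝ (Fin 3)) {ρ : ℝ} (hρ : 0 < ρ) :
    hardyEnergyBound_ledger_cutoff c hρ = fun x => hardyEnergyBound_ledger_cutoff 0 hρ (x - c) := by
  funext x
  simp only [hardyEnergyBound_ledger_cutoff, hardyEnergyBound_ledger_bump, ContDiffBump.apply, sub_zero]

/-- `Dφ_c(x) = Dφ_0(x − c)`. -/
theorem hardyEnergyBound_converse_fderiv_translate (c x : EuclideanSpace ℝ (Fin 3)) {ρ : ℝ} (hρ : 0 < ρ) :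
    fderiv ℝ (hardyEnergyBound_ledger_cutoff c hρ) x =
      fderiv ℝ (hardyEnergyBound_ledger_cutoff 0 hρ) (x - c) := by
  rw [hardyEnergyBound_converse_cutoff_translate c hρ, fderiv_comp_sub]

/-- `Δφ_c(x) = Δφ_0(x − c)`. -/
theorem hardyEnergyBound_converse_laplacian_translate (c x : EuclideanSpace ℝ (Fin 3)) {ρ : ℝ} (hρ : 0 < ρ) :
    (Δ (hardyEnergyBound_ledger_cutoff c hρ)) x = (Δ (hardyEnergyBound_ledger_cutoff 0 hρ)) (x - c) := by
  rw [hardyEnergyBound_converse_cutoff_translate c hρ,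
    InnerProductSpace.laplacian_eq_iteratedFDeriv_stdOrthonormalBasis,
    InnerProductSpace.laplacian_eq_iteratedFDeriv_stdOrthonormalBasis]
  simp only [iteratedFDeriv_comp_sub]

/-- Uniform-in-the-centre bounds of `Dφ_c` and `Δφ_c`. -/
theorem hardyEnergyBound_converse_exists_bounds {ρ : ℝ} (hρ : 0 < ρ) :
    ∃ L₁ L₂ : ℝ, 0 ≤ L₁ ∧ 0 ≤ L₂ ∧
      (∀ c x, ‖fderiv ℝ (hardyEnergyBound_ledger_cutoff c hρ) x‖ ≤ L₁) ∧
      ∀ c x, |(Δ (hardyEnergyBound_ledger_cutoff c hρ)) x| ≤ L₂ := by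
  obtain ⟨L₁, hL₁0, hL₁⟩ := hardyEnergyBound_ledger_exists_bound_fderiv_cutoff
    (0 : EuclideanSpace ℝ (Fin 3)) hρ
  obtain ⟨L₂, hL₂0, hL₂⟩ := hardyEnergyBound_ledger_exists_bound_laplacian_cutoff
    (0 : EuclideanSpace ℝ (Fin 3)) hρ
  refine ⟨L₁, L₂, hL₁0, hL₂0, fun c x => ?_, fun c x => ?_⟩
  · rw [hardyEnergyBound_converse_fderiv_translate]; exact hL₁ _
  · rw [hardyEnergyBound_converse_laplacian_translate]; exact hL₂ _

/-! ### The influx deficit and the weighted influx over a large ball -/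

/-- **Influx deficit over an arbitrary set.** For the plateau cut-off `φ` at `c` (scale `ρ`) and a
sink `x₀ ∈ B(c, ρ/4)`: `|∫_S (φ − 1) flux_Π| ≤ (16/ρ²)(1/2 + C_{3/2}) ∫ |w|³`. -/
theorem hardyEnergyBound_converse_abs_integral_deficit_le {c x₀ : EuclideanSpace ℝ (Fin 3)} {ρ : ℝ}
    (hρ : 0 < ρ) (hx₀ : x₀ ∈ ball c (ρ / 4))
    {w : (EuclideanSpace ℝ (Fin 3)) → (EuclideanSpace ℝ (Fin 3))} (hw3 : MemLp w 3 volume)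
    (S : Set (EuclideanSpace ℝ (Fin 3))) :
    |∫ x in S, (hardyEnergyBound_ledger_cutoff c hρ x - 1) *
        hardyEnergyBound_ledgerFlux w (rieszPressure w) x₀ x| ≤
      16 / ρ ^ 2 * (1 / 2 + steinConstThreeHalves) * ∫ x, ‖w x‖ ^ 3 := by
  obtain ⟨hPw, -⟩ := hardyEnergyBound_ledger_integral_abs_rieszPressure_mul_norm_le hw3
  have h3 : IntegrableOn (fun x => 16 / ρ ^ 2 / 2 * ‖w x‖ ^ 3) S :=
    ((hw3.integrable_norm_pow three_ne_zero).const_mul _).integrableOn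
  have hP : IntegrableOn (fun x => 16 / ρ ^ 2 * (|rieszPressure w x| * ‖w x‖)) S :=
    (hPw.const_mul _).integrableOn
  have hb : ∀ x, ‖(hardyEnergyBound_ledger_cutoff c hρ x - 1) *
      hardyEnergyBound_ledgerFlux w (rieszPressure w) x₀ x‖ ≤
      16 / ρ ^ 2 / 2 * ‖w x‖ ^ 3 + 16 / ρ ^ 2 * (|rieszPressure w x| * ‖w x‖) := fun x => by
    rw [Real.norm_eq_abs]
    refine (hardyEnergyBound_ledger_abs_sub_one_mul_ledgerFlux_le hρ hx₀ w _ x).trans_eq ?_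
    ring
  have hg : IntegrableOn (fun x => 16 / ρ ^ 2 / 2 * ‖w x‖ ^ 3 +
      16 / ρ ^ 2 * (|rieszPressure w x| * ‖w x‖)) S := h3.add hP
  rw [← Real.norm_eq_abs]
  refine (norm_integral_le_of_norm_le hg (Eventually.of_forall hb)).trans ?_
  rw [integral_add h3 hP, integral_const_mul, integral_const_mul]
  rw [show 16 / ρ ^ 2 * (1 / 2 + steinConstThreeHalves) * ∫ x, ‖w x‖ ^ 3 = 16 / ρ ^ 2 / 2 *
    (∫ x, ‖w x‖ ^ 3) + 16 / ρ ^ 2 * (steinConstThreeHalves * ∫ x, ‖w x‖ ^ 3) by ring]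
  have h4 : 0 ≤ 16 / ρ ^ 2 / 2 := by positivity
  have h8 : 0 ≤ 16 / ρ ^ 2 := by positivity
  exact add_le_add (mul_le_mul_of_nonneg_left (hardyEnergyBound_ledger_setIntegral_cube_le hw3 _) h4)
    (mul_le_mul_of_nonneg_left
      (hardyEnergyBound_ledger_setIntegral_abs_rieszPressure_mul_le hw3 _) h8)

/-- **Collecting the weighted influx on a ball containing the cut-off's support.** If `q = Π[w] + k`
a.e. for continuous `w ∈ L³` and `q`, then on every ball `B ⊇ B(c, ρ)`:
`∫_B (φ − 1) flux_Π + ∫_B flux_Π = ∫ φ flux_Π`. -/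
theorem hardyEnergyBound_converse_influx_collect {c x₀ xs : EuclideanSpace ℝ (Fin 3)} {ρ R : ℝ}
    (hρ : 0 < ρ) (hsub : ball c ρ ⊆ ball xs R)
    {w : (EuclideanSpace ℝ (Fin 3)) → (EuclideanSpace ℝ (Fin 3))} (hw : Continuous w)
    {q : (EuclideanSpace ℝ (Fin 3)) → ℝ} (hq : Continuous q) {k : ℝ}
    (hqc : ∀ᵐ x ∂(volume : Measure (EuclideanSpace ℝ (Fin 3))), q x = rieszPressure w x + k) :
    (∫ x in ball xs R, (hardyEnergyBound_ledger_cutoff c hρ x - 1) *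
        hardyEnergyBound_ledgerFlux w (rieszPressure w) x₀ x) +
      (∫ x in ball xs R, hardyEnergyBound_ledgerFlux w (rieszPressure w) x₀ x) =
      ∫ x, hardyEnergyBound_ledger_cutoff c hρ x *
        hardyEnergyBound_ledgerFlux w (rieszPressure w) x₀ x := by
  set φ := hardyEnergyBound_ledger_cutoff c hρ with hφ
  set P := rieszPressure w with hP
  -- `flux_P` is integrable on the ball
  have hfluxP : IntegrableOn (hardyEnergyBound_ledgerFlux w P x₀) (ball xs R) := by
    have h1 : IntegrableOn (hardyEnergyBound_ledgerFlux w q x₀) (ball xs R) :=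
      hardyEnergyBound_ledger_integrableOn_ledgerFlux hw hq
    have h2 : IntegrableOn (fun x => k * (inner ℝ (w x) (x - x₀) / ‖x - x₀‖ ^ 3)) (ball xs R) :=
      (hardyEnergyBound_ledger_integrableOn_inner_div hw).const_mul k
    refine (h1.sub h2).congr ?_
    filter_upwards [ae_restrict_of_ae (s := ball xs R) hqc] with x hx
    rw [Pi.sub_apply]
    simp only [hardyEnergyBound_ledgerFlux, hx]
    ring
  -- `φ flux_P` is integrable
  have hCq : Integrable (hardyEnergyBound_ledgerC φ w q x₀) :=
    hardyEnergyBound_ledger_integrable_ledgerC hρ hw hq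
  have hI : Integrable fun x => φ x * inner ℝ (w x) (x - x₀) / ‖x - x₀‖ ^ 3 :=
    hardyEnergyBound_ledger_integrable_cutoff_mul_inner_div hρ hw
  have hφfluxP : Integrable fun x => φ x * hardyEnergyBound_ledgerFlux w P x₀ x := by
    refine ((hCq.sub (hI.const_mul (2 * k))).const_mul (1 / 2)).congr ?_
    filter_upwards [hqc] with x hx
    simp only [Pi.sub_apply, hardyEnergyBound_ledgerC, hardyEnergyBound_ledgerFlux, hx]
    ring
  have hdef : IntegrableOn (fun x => (φ x - 1) * hardyEnergyBound_ledgerFlux w P x₀ x) (ball xs R) := by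
    refine (hφfluxP.integrableOn.sub hfluxP).congr (Eventually.of_forall fun x => ?_)
    rw [Pi.sub_apply]
    ring
  rw [← integral_add hdef hfluxP]
  have e1 : ∫ x in ball xs R, ((φ x - 1) * hardyEnergyBound_ledgerFlux w P x₀ x +
      hardyEnergyBound_ledgerFlux w P x₀ x) =
      ∫ x in ball xs R, φ x * hardyEnergyBound_ledgerFlux w P x₀ x :=
    integral_congr_ae (Eventually.of_forall fun x => by ring)
  rw [e1]
  refine setIntegral_eq_integral_of_forall_compl_eq_zero fun x hx => ?_
  have h0 : φ x = 0 := by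
    by_contra h
    exact hx (hsub (hardyEnergyBound_ledger_mem_ball_of_cutoff_ne_zero c hρ h))
  rw [h0, zero_mul]

/-- **Anchor of this helper file** (registered sub-goal of `hardyEnergyBound_influxAbsorption_of_crux`):
`ofReal ∫_{(a,b)} f ≤ ∫⁻_{(a,b)} ofReal f` for every real `f` on every time window. -/
theorem hardyEnergyBound_converse_ofRealIntegral :
    ∀ (f : ℝ → ℝ) (a b : ℝ), ENNReal.ofReal (∫ s in Set.Ioo a b, f s) ≤
      ∫⁻ s in Set.Ioo a b, ENNReal.ofReal (f s) :=
  fun f _ _ => ofReal_integral_le_lintegral_ofReal f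

end Summit.NavierStokesRegularity.NavierStokesRegularity.Theorems

end
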